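import Summits.QuantumFields.YangMills.Theorems.UnitScaleTiltFluctuationComparisonRegPrGlobalSlackKernelMatchingCompose
import Summits.QuantumFields.YangMills.Theorems.UnitScaleTiltFluctuationComparisonRegPrGlobalSlackKernelCauchyEstimates
import Summits.QuantumFields.YangMills.Theorems.UnitScaleTiltFluctuationComparisonRegPrGlobalSlackLocalToGlobal
import Summits.QuantumFields.YangMills.Theorems.UnitScaleTiltFluctuationComparisonRegPrRepAtHeightsV3FamBase
import HarnessLib

/-!
# `UnitScaleTiltFluctuationComparisonRegPrGlobalSlackKernelEndToEnd` — THE K1a LINE END TO END, BY NAME: chart rows + producer rows ⟹ the tail of STUB 3⁗,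
# and the 3⁗-SHAPED REDUCTION `globalTwoRunSlackFam_of_k1aLine` (crux `FluctuationComparisonRegPrL`, stmt-QuantumFields-19935; width-lever lane A)

Seat ym-ust-19935-slack g0 (prover).  The two halves of the K1a kernel-matching line are in the tree: the PRODUCER (local ⇒ global with King's slack,
`GlobalSlackLocalToGlobal.globalTwoRunSlackTail_of_polymerSlack`, port of ym-cruxidea-19201-1 g11 by ym3-torus-p2 g14, p530498) and the INTERFACE COMPOSITION
(`GlobalSlackKernelMatching.polymerCauchyMinAtTSlack_of_charts`, port of ym-cruxidea-19201-1 g12, p529311/p530624).  This file chains them: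

* §1 `polymerCauchyMinAtTSlack_iff_localToGlobal : GlobalSlackKernelMatching.PolymerCauchyMinAtTSlack … ↔ GlobalSlackLocalToGlobal.PolymerCauchyMinAtTSlack …`
  (`Iff.rfl`: the two ports carry the g9/g11 text verbatim) and `remainderSmallΦ_zero` (the zero rest satisfies the remainder row with constant `0`).
* §2 AT AN ABSTRACT DATUM `D`: **`globalTwoRunSlackTail_of_charts`** — the six chart rows over one chart family (`TaylorSplitΦ`, K1a `FlatKernelCauchyΦ`, `KernelSizeΦ`,
  `RemainderSmallΦ`, `CfgSizeΦ`, `CfgCauchyΦ (ℓ ≡ 1)`) and the five producer rows (`PintDecompTrivT`, `LocCover`, `LocBlockVolume`, `LocMatched`, `TermSizeTrivT`) give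
  `∃ σ₀ C₀, 7 ≤ σ₀ ∧ 0 ≤ C₀ ∧ GlobalSlack.GlobalSupRateTSlack D b₀ p₀ a σ₀ C₀` — the conclusion of 3⁗ after `∃ p … ∃ π`; PURE-FIRST variant
  `globalTwoRunSlackTail_of_polyCharts` (`PolySplitΦ`, no rest; OWNER RULING g20-№11 ADDENDUM 3 of record); ANALYTIC variant
  **`globalTwoRunSlackTail_of_analyticCharts`** — the DISPLAYED rows `ChartAnalyticΦ` (G3D-01) + `Deriv1VanishΦ` ((32)) + the far row replace `KernelSizeΦ` and
  `RemainderSmallΦ` (file `…KernelCauchyEstimates`, p531504), for the canonical term function `termOfCharts Φ B Rfar`: FOUR independent chart rows remain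
  (K1a `FlatKernelCauchyΦ`, `CfgSizeΦ`, `CfgCauchyΦ`, far) next to the two displayed ones.
* §2c KEEP-g RIDER (ideator-1 g13 (B), OWNER RULING g21-№2 §D (B)): `ChartAnalyticGΦ` = G3D-01 with the birth coupling KEPT (`C_A·g K b·e^{−κ𝓛}`, `0 ≤ g ≤ 1` —
  print (25) «O(g₀)e^{−κ𝓛(X)}»), `KernelSizeGΦ` (kernel size with `g`), `kernelSizeGΦ_of_chartAnalyticG` (Cauchy inequalities verbatim), and the lossy
  projections `chartAnalyticΦ_of_G` / `kernelSizeΦ_of_G` (`g ≤ 1`); no interface change.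
* §3 THE 3⁗-SHAPED REDUCTION: `K1aLine L 𝔠 a₀ a₁ a` — for one constants record, constants BOUND BEFORE the family (print: «O(1) independent of ε, k»), a coupling
  threshold, and for every family / coupling / inhabited v3 package: the window `(C_s + C_B)·θ(n) ≤ 1`, a coherent family `p` with the given [7]-constants, a polymer
  parameter `π`, a term function, ONE chart family over the lane's chart space `↥(lieC (suGroupModel 2))` with configurations / vacuum constants / rests, and the
  ELEVEN ROWS at `dataOfV3 p π`; **`globalTwoRunSlackFam_of_k1aLine`**: `(∀ L …, ∃ a, 0 < a ∧ a < 1 ∧ K1aLine L 𝔠 a₀ a₁ a) →` THE REGISTERED TEXT OF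
  `stub_globalTwoRunSlackFam` VERBATIM (threshold `γB ⊓ e^{2(1−p₀)}` for the producer's monotonicity window `√γ ≤ e^{1−p₀}`).
So the registered 3⁗ is, BY NAME, the eleven typed rows of the K1a line; which of them are displayed / derived / two-run is the seat's REPORT-K1a-display-g0.md
(stmt-QuantumFields-19935 evidence 2026-08-27T12:26Z).  Every `def` is a hypothesis schema; nothing of [Balaban1985UV3]/[King1986] is asserted.

References: C. King, CMP 102 (1986) 649–677 [King1986] (Thm 3.4 (3.9) p.656, Prop. 3.6 (3.55)–(3.57) p.662, Props 3.8–3.9 pp.664–665); T. Bałaban, CMP 102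
(1985) 255–275 [Balaban1985UV3] ((28)–(30) p.263, (33)–(34) p.264, (43)–(46) pp.266–267, (57) p.270); CMP 102 (1985) 277–309 [Balaban1985Variational] (Thm 1 (8) p.279).
-/

set_option autoImplicit false

noncomputable section

open scoped BigOperators
open Literature.MathematicalPhysics.QuantumFieldTheory.Balaban1983to89
open Literature.MathematicalPhysics.QuantumFieldTheory.Balaban1983to89.T3ContinuumYM3Torus
open Literature.MathematicalPhysics.QuantumFieldTheory.Balaban1983to89.T3UnitScaleTilt
open Literature.MathematicalPhysics.QuantumFieldTheory.Balaban1983to89.T3LevelShift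
open Literature.MathematicalPhysics.QuantumFieldTheory.Balaban1983to89.T3AlphaInputsAC
open Literature.MathematicalPhysics.QuantumFieldTheory.Balaban1983to89.T3AlphaPolymerSocket
open Literature.MathematicalPhysics.QuantumFieldTheory.Balaban1983to89.T3AlphaInputsACTwoRun
open Literature.MathematicalPhysics.QuantumFieldTheory.Balaban1983to89.T3AlphaInputsACTwoRunLevel
open Summit.QuantumFields.Balaban3D.Carriers
open Summit.QuantumFields.Balaban3D.Proofs.Primitives
open Summit.QuantumFields.Balaban3D.Proofs.GroupModelLieC (lieC)
open Summit.QuantumFields.YangMills.Theorems.GlobalSlack (GlobalSupRateTSlack)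
open Literature.MathematicalPhysics.QuantumFieldTheory.Balaban1985CMP102.Binders (ChartAnalyticityAsCited)

namespace Summit.QuantumFields.YangMills.Theorems.GlobalSlackKernelMatching

variable {𝕍 : Type} [NormedAddCommGroup 𝕍] [NormedSpace ℂ 𝕍] {F : T3Family} {γ : ℝ}

/-! ## §1 Bridges -/

/-- The two ports of the local slack row carry the SAME text (sketches g9/g11): `Iff.rfl`. [cite: King1986, Thm 3.4 (3.9) p.656] -/
theorem polymerCauchyMinAtTSlack_iff_localToGlobal (D : AlphaDataT3 F γ) (PT : TermFn F) (b₀ p₀ κ₁ a : ℝ) (σ : ℕ) (C : ℝ) :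
    PolymerCauchyMinAtTSlack D PT b₀ p₀ κ₁ a σ C ↔ GlobalSlackLocalToGlobal.PolymerCauchyMinAtTSlack D PT b₀ p₀ κ₁ a σ C :=
  Iff.rfl

/-- The zero rest satisfies the remainder row with constant `0` (for the pure-first composition through the slack lemma). [folklore] -/
theorem remainderSmallΦ_zero (D : AlphaDataT3 F γ) (b₀ p₀ κ : ℝ) :
    RemainderSmallΦ D (fun _ _ _ _ _ => (0 : ℝ)) b₀ p₀ κ 0 := by
  intro K n _ j _ V _ Y _
  simp

/-! ## §2 The line end to end at an abstract datum -/

/-- **THE K1a LINE END TO END (slack form of record)**: for `0 < γ ≤ 1`, `√γ ≤ e^{1−p₀}`, `0 < b₀`, `0 ≤ p₀`, `0 < a < 1`, nonnegative constants and the window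
`(C_s + C_B)·θ(n) ≤ 1`: the SIX chart rows over one chart family and the FIVE producer rows give the tail of 3⁗,
`∃ σ₀ C₀, 7 ≤ σ₀ ∧ 0 ≤ C₀ ∧ GlobalSupRateTSlack D b₀ p₀ a σ₀ C₀` (`σ₀ = 7`). [cite: King1986, Thm 3.4 (3.9) p.656, Prop. 3.6 p.662; Balaban1985UV3, (43)-(46) pp.266-267, (57) p.270] -/
theorem globalTwoRunSlackTail_of_charts {D : AlphaDataT3 F γ} {PT : TermFn F} {Φ : ChartFam 𝕍 F} {e : VacFam F} {B : CfgFam 𝕍 F} {R : RemFam F}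
    {b₀ p₀ κ a C C_E C_R C_s C_B C_T C' : ℝ}
    (hγ : 0 < γ) (hγ1 : γ ≤ 1) (hγe : Real.sqrt γ ≤ Real.exp (1 - p₀)) (hb : 0 < b₀) (hp : 0 ≤ p₀) (ha : 0 < a) (ha1 : a < 1)
    (hC : 0 ≤ C) (hCE : 0 ≤ C_E) (hCR : 0 ≤ C_R) (hCs : 0 ≤ C_s) (hCB : 0 ≤ C_B) (hCT : 0 ≤ C_T)
    (hθ1 : ∀ n, (C_s + C_B) * θBal F.L γ b₀ p₀ n ≤ 1)
    (hdec : PintDecompTrivT D PT) (hLC : LocCover D κ C') (hBV : LocBlockVolume D) (hLM : LocMatched D) (hTS : TermSizeTrivT D PT b₀ p₀ C_T κ)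
    (hT : TaylorSplitΦ PT Φ e B R) (hK : FlatKernelCauchyΦ D Φ κ a C) (hE : KernelSizeΦ D Φ κ C_E)
    (hR : RemainderSmallΦ D R b₀ p₀ κ C_R) (hS : CfgSizeΦ D B b₀ p₀ C_s) (hBC : CfgCauchyΦ D B b₀ p₀ a C_B fun _ => 1) :
    ∃ (σ₀ : ℕ) (C₀ : ℝ), 7 ≤ σ₀ ∧ 0 ≤ C₀ ∧ GlobalSupRateTSlack D b₀ p₀ a σ₀ C₀ := by
  have hL1 : (1 : ℝ) ≤ (F.L : ℝ) := by exact_mod_cast F.hL.2.le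
  have hθ0 : ∀ n, 0 ≤ θBal F.L γ b₀ p₀ n := fun n => (T3MinimiserStabilityReduction.θBal_pos F.hL.2.le hγ hγ1 hb p₀ n).le
  have hPC := polymerCauchyMinAtTSlack_of_charts hC hCE hCR hCs hCB hL1 hθ0 hθ1 hT hK hE hR hS hBC
  exact GlobalSlackLocalToGlobal.globalTwoRunSlackTail_of_polymerSlack hγ hγ1 hγe hb hp ha ha1 (by positivity) hCT le_rfl
    hdec hLC hBV hLM hTS ((polymerCauchyMinAtTSlack_iff_localToGlobal D PT b₀ p₀ κ a 7 _).1 hPC)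

/-- **THE K1a LINE END TO END, PURE-FIRST** (OWNER RULING g20-№11 ADDENDUM 3 of record: print's (43) activities are exact polynomials, `R ≡ 0`): `PolySplitΦ`
instead of `TaylorSplitΦ`/`RemainderSmallΦ`; same conclusion (through `taylorSplit_of_polySplit` and the zero rest). [cite: King1986, Thm 3.4 (3.9) p.656; Balaban1985UV3, (33)-(34) p.264, (43)-(44) pp.266-267] -/
theorem globalTwoRunSlackTail_of_polyCharts {D : AlphaDataT3 F γ} {PT : TermFn F} {Φ : ChartFam 𝕍 F} {e : VacFam F} {B : CfgFam 𝕍 F}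
    {b₀ p₀ κ a C C_E C_s C_B C_T C' : ℝ}
    (hγ : 0 < γ) (hγ1 : γ ≤ 1) (hγe : Real.sqrt γ ≤ Real.exp (1 - p₀)) (hb : 0 < b₀) (hp : 0 ≤ p₀) (ha : 0 < a) (ha1 : a < 1)
    (hC : 0 ≤ C) (hCE : 0 ≤ C_E) (hCs : 0 ≤ C_s) (hCB : 0 ≤ C_B) (hCT : 0 ≤ C_T)
    (hθ1 : ∀ n, (C_s + C_B) * θBal F.L γ b₀ p₀ n ≤ 1)
    (hdec : PintDecompTrivT D PT) (hLC : LocCover D κ C') (hBV : LocBlockVolume D) (hLM : LocMatched D) (hTS : TermSizeTrivT D PT b₀ p₀ C_T κ)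
    (hP : PolySplitΦ PT Φ e B) (hK : FlatKernelCauchyΦ D Φ κ a C) (hE : KernelSizeΦ D Φ κ C_E)
    (hS : CfgSizeΦ D B b₀ p₀ C_s) (hBC : CfgCauchyΦ D B b₀ p₀ a C_B fun _ => 1) :
    ∃ (σ₀ : ℕ) (C₀ : ℝ), 7 ≤ σ₀ ∧ 0 ≤ C₀ ∧ GlobalSupRateTSlack D b₀ p₀ a σ₀ C₀ :=
  globalTwoRunSlackTail_of_charts hγ hγ1 hγe hb hp ha ha1 hC hCE le_rfl hCs hCB hCT hθ1 hdec hLC hBV hLM hTS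
    (taylorSplit_of_polySplit hP) hK hE (remainderSmallΦ_zero D b₀ p₀ κ) hS hBC

/-! ## §2b The analytic variant: displayed rows in, two interface rows out -/

/-- **THE K1a LINE END TO END FROM THE DISPLAYED CHART ROWS** (finite-dimensional colour space): `ChartAnalyticΦ` (G3D-01), `Deriv1VanishΦ` ((32)), the far-terms
row `RemainderSmallΦ D Rfar … C_f` (G3D-06), `CfgSizeΦ` ((28)), `CfgCauchyΦ (ℓ ≡ 1)` (19200-side) and K1a `FlatKernelCauchyΦ`, on the windows `(C_s + C_B)·θ(n) ≤ 1`,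
`C_s·θ(n) ≤ ρ/4`, together with the five producer rows for the CANONICAL term function `termOfCharts Φ B Rfar`, give the tail of 3⁗ — `KernelSizeΦ` and the Taylor
part of `RemainderSmallΦ` being theorems (`kernelSizeΦ_of_chartAnalytic`, `remainderSmallΦ_of_chartAnalytic`, p531504).
[cite: Balaban1985UV3, (25) p.262, (28)-(30) p.263, (32)-(34) p.264, (43)-(46) pp.266-267, (57) p.270; King1986, Thm 3.4 (3.9) p.656, Prop. 3.6 p.662] -/
theorem globalTwoRunSlackTail_of_analyticCharts [FiniteDimensional ℂ 𝕍] {D : AlphaDataT3 F γ} {Φ : ChartFam 𝕍 F} {B : CfgFam 𝕍 F} {Rfar : RemFam F}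
    {b₀ p₀ κ ρ a C C_A C_f C_s C_B C_T C' : ℝ}
    (hγ : 0 < γ) (hγ1 : γ ≤ 1) (hγe : Real.sqrt γ ≤ Real.exp (1 - p₀)) (hb : 0 < b₀) (hp : 0 ≤ p₀) (ha : 0 < a) (ha1 : a < 1)
    (hC : 0 ≤ C) (hCA : 0 ≤ C_A) (hCf : 0 ≤ C_f) (hCs : 0 ≤ C_s) (hCB : 0 ≤ C_B) (hCT : 0 ≤ C_T) (hρ : 0 < ρ)
    (hθ1 : ∀ n, (C_s + C_B) * θBal F.L γ b₀ p₀ n ≤ 1) (hwin : ∀ n, C_s * θBal F.L γ b₀ p₀ n ≤ ρ / 4)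
    (hdec : PintDecompTrivT D (termOfCharts Φ B Rfar)) (hLC : LocCover D κ C') (hBV : LocBlockVolume D) (hLM : LocMatched D)
    (hTS : TermSizeTrivT D (termOfCharts Φ B Rfar) b₀ p₀ C_T κ)
    (hA : ChartAnalyticΦ D Φ κ ρ C_A) (h32 : Deriv1VanishΦ Φ) (hfar : RemainderSmallΦ D Rfar b₀ p₀ κ C_f)
    (hK : FlatKernelCauchyΦ D Φ κ a C) (hS : CfgSizeΦ D B b₀ p₀ C_s) (hBC : CfgCauchyΦ D B b₀ p₀ a C_B fun _ => 1) :
    ∃ (σ₀ : ℕ) (C₀ : ℝ), 7 ≤ σ₀ ∧ 0 ≤ C₀ ∧ GlobalSupRateTSlack D b₀ p₀ a σ₀ C₀ := by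
  have hL1 : (1 : ℝ) ≤ (F.L : ℝ) := by exact_mod_cast F.hL.2.le
  have hθ0 : ∀ n, 0 ≤ θBal F.L γ b₀ p₀ n := fun n => (T3MinimiserStabilityReduction.θBal_pos F.hL.2.le hγ hγ1 hb p₀ n).le
  have hCR : 0 ≤ 2 * C_A * (2 * C_s / ρ) ^ 7 + C_f := by positivity
  exact globalTwoRunSlackTail_of_charts hγ hγ1 hγe hb hp ha ha1 hC (by positivity) hCR hCs hCB hCT hθ1 hdec hLC hBV hLM hTS
    (taylorSplit_termOfCharts Φ B Rfar) hK (kernelSizeΦ_of_chartAnalytic hA)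
    (remainderSmallΦ_of_chartAnalytic hCA hCs hρ hL1 hθ0 hwin hA h32 hS hfar) hS hBC

/-! ## §2c The keep-`g` rider: G3D-01 with the birth coupling kept, and the lossy projections -/

/-- **CHART ANALYTICITY WITH THE BIRTH COUPLING KEPT** (hypothesis schema, never asserted): as `ChartAnalyticΦ` but with bound `C_A·g K b·e^{−κ𝓛_K(Y)}` for a coupling
profile `0 ≤ g K b ≤ 1` — the displayed `chart` row VERBATIM (`𝔠.C25 * S.gk k * exp(−𝔠.κ·dj Y)`, print (25) «|𝒫′₁(g₀, X, U₁)| ≤ O(g₀)e^{−κ𝓛(X)}»); the refined chart of run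
`K+1` carries the same `g K b` (matched steps have the same running coupling). [cite: Balaban1985UV3, (25) p.262, (34) p.264] -/
def ChartAnalyticGΦ (D : AlphaDataT3 F γ) (Φ : ChartFam 𝕍 F) (κ ρ C_A : ℝ) (g : ℕ → ℕ → ℝ) : Prop :=
  (∀ K b, 0 ≤ g K b ∧ g K b ≤ 1) ∧
  ∀ (K k b : ℕ) (Y : Set (Site (F.P K) 0)), Y ∈ D.Loc K k (D.triv K k) (1 + b) →
    ChartAnalyticityAsCited (Φ K b Y) ρ (C_A * g K b * Real.exp (-κ * D.treeLen K (1 + b) Y)) ∧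
    ChartAnalyticityAsCited (Φ (K + 1) (b + 1) (refineSet F K Y)) ρ (C_A * g K b * Real.exp (-κ * D.treeLen K (1 + b) Y))

/-- **KERNEL SIZE WITH THE BIRTH COUPLING KEPT** (hypothesis schema, never asserted): `‖ker Φ K b Y d‖ ≤ C_E·g K b·e^{−κ𝓛}` — print's (34) «|𝒫₁(g₀, Y)| ≤ O(g₀)Π exp(…)»
before (43)/(44) drop the coupling into O(1). [cite: Balaban1985UV3, (34) p.264] -/
def KernelSizeGΦ (D : AlphaDataT3 F γ) (Φ : ChartFam 𝕍 F) (κ C_E : ℝ) (g : ℕ → ℕ → ℝ) : Prop :=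
  ∀ (K k b : ℕ) (Y : Set (Site (F.P K) 0)), Y ∈ D.Loc K k (D.triv K k) (1 + b) →
    ∀ d ∈ Finset.Ico 2 7, ‖ker Φ K b Y d‖ ≤ C_E * g K b * Real.exp (-κ * D.treeLen K (1 + b) Y)

/-- `ChartAnalyticityAsCited` is monotone in the bound. [folklore] -/
theorem chartAnalyticityAsCited_mono {E : Type*} [NormedAddCommGroup E] [NormedSpace ℂ E] {Ψ : E → ℂ} {ρ M M' : ℝ}
    (h : ChartAnalyticityAsCited Ψ ρ M) (hM : M ≤ M') : ChartAnalyticityAsCited Ψ ρ M' :=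
  ⟨h.1, h.2.1, fun z hz => (h.2.2 z hz).trans hM⟩

/-- **KEEP-g KERNEL SIZE IS A THEOREM UNDER KEEP-g G3D-01** (the Cauchy inequalities of p531504 verbatim, `M = C_A·g·e^{−κ𝓛}`). [cite: Balaban1985UV3, (34) p.264] -/
theorem kernelSizeGΦ_of_chartAnalyticG {D : AlphaDataT3 F γ} {Φ : ChartFam 𝕍 F} {κ ρ C_A : ℝ} {g : ℕ → ℕ → ℝ}
    (h : ChartAnalyticGΦ D Φ κ ρ C_A g) : KernelSizeGΦ D Φ κ (C_A * (max 1 (12 / ρ)) ^ 6) g := by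
  intro K k b Y hY d hd
  have hd6 : d ≤ 6 := by have := (Finset.mem_Ico.mp hd).2; omega
  have key := norm_iteratedFDeriv_zero_le_uniform (h.2 K k b Y hY).1 hd6
  calc ‖ker Φ K b Y d‖ = ‖iteratedFDeriv ℂ d (Φ K b Y) 0‖ := rfl
    _ ≤ C_A * g K b * Real.exp (-κ * D.treeLen K (1 + b) Y) * (max 1 (12 / ρ)) ^ 6 := key
    _ = C_A * (max 1 (12 / ρ)) ^ 6 * g K b * Real.exp (-κ * D.treeLen K (1 + b) Y) := by ring

/-- The lossy projection of the chart row: keep-g G3D-01 implies `ChartAnalyticΦ` (`g ≤ 1`, `C_A ≥ 0`). [cite: Balaban1985UV3, (25) p.262] -/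
theorem chartAnalyticΦ_of_G {D : AlphaDataT3 F γ} {Φ : ChartFam 𝕍 F} {κ ρ C_A : ℝ} {g : ℕ → ℕ → ℝ} (hCA : 0 ≤ C_A)
    (h : ChartAnalyticGΦ D Φ κ ρ C_A g) : ChartAnalyticΦ D Φ κ ρ C_A := by
  intro K k b Y hY
  obtain ⟨h1, h2⟩ := h.2 K k b Y hY
  have hle : C_A * g K b * Real.exp (-κ * D.treeLen K (1 + b) Y) ≤ C_A * Real.exp (-κ * D.treeLen K (1 + b) Y) := by
    have he : 0 ≤ Real.exp (-κ * D.treeLen K (1 + b) Y) := (Real.exp_pos _).le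
    calc C_A * g K b * Real.exp (-κ * D.treeLen K (1 + b) Y) ≤ C_A * 1 * Real.exp (-κ * D.treeLen K (1 + b) Y) :=
          mul_le_mul_of_nonneg_right (mul_le_mul_of_nonneg_left (h.1 K b).2 hCA) he
      _ = _ := by rw [mul_one]
  exact ⟨chartAnalyticityAsCited_mono h1 hle, chartAnalyticityAsCited_mono h2 hle⟩

/-- The lossy projection of the kernel row: keep-g kernel size implies `KernelSizeΦ` (`g ≤ 1`, `C_E ≥ 0`). [cite: Balaban1985UV3, (34) p.264, (44) p.267] -/
theorem kernelSizeΦ_of_G {D : AlphaDataT3 F γ} {Φ : ChartFam 𝕍 F} {κ C_E : ℝ} {g : ℕ → ℕ → ℝ} (hCE : 0 ≤ C_E) (hg : ∀ K b, 0 ≤ g K b ∧ g K b ≤ 1)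
    (h : KernelSizeGΦ D Φ κ C_E g) : KernelSizeΦ D Φ κ C_E := by
  intro K k b Y hY d hd
  refine (h K k b Y hY d hd).trans ?_
  have he : 0 ≤ Real.exp (-κ * D.treeLen K (1 + b) Y) := (Real.exp_pos _).le
  calc C_E * g K b * Real.exp (-κ * D.treeLen K (1 + b) Y) ≤ C_E * 1 * Real.exp (-κ * D.treeLen K (1 + b) Y) :=
        mul_le_mul_of_nonneg_right (mul_le_mul_of_nonneg_left (hg K b).2 hCE) he
    _ = _ := by rw [mul_one]

/-! ## §3 The 3⁗-shaped reduction -/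

/-- **THE K1a LINE FOR ONE CONSTANTS RECORD** (hypothesis schema, never asserted): constants `κ, C, C_E, C_R, C_s, C_B, C_T, C′ ≥ 0` bound BEFORE the family, a coupling
threshold `γB > 0`, and for every family of block size `L`, every coupling `γ ≤ γB` in the lane's window and every inhabited v3 package: the window
`(C_s + C_B)·θ(n) ≤ 1` (the configurations stay inside the charts' balls, (28)), a COHERENT admissible family `p : ∀ K, PkgAtV3 …` with the given [7]-constants,
a polymer parameter `π`, a term function `PT`, ONE chart family `Φ` over the lane's chart space with configurations `B`, vacuum constants `e`, rests `R`, and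
THE ELEVEN ROWS at `D := dataOfV3 p π`: producer side `PintDecompTrivT`, `LocCover`, `LocBlockVolume`, `LocMatched`, `TermSizeTrivT`; chart side `TaylorSplitΦ`,
K1a `FlatKernelCauchyΦ`, `KernelSizeΦ`, `RemainderSmallΦ`, `CfgSizeΦ`, `CfgCauchyΦ (ℓ ≡ 1)`.  Rate exponent `a` is the argument.
[cite: King1986, Thm 3.4 (3.9) p.656, Prop. 3.6 p.662; Balaban1985UV3, (28)-(30) p.263, (43)-(46) pp.266-267, (57) p.270] -/
def K1aLine (L : ℕ) (𝔠 : AlphaConsts L (suGroupModel 2).N) (a₀ a₁ a : ℝ) : Prop :=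
  ∃ (κ C C_E C_R C_s C_B C_T C' γB : ℝ), 0 ≤ C ∧ 0 ≤ C_E ∧ 0 ≤ C_R ∧ 0 ≤ C_s ∧ 0 ≤ C_B ∧ 0 ≤ C_T ∧ 0 < γB ∧
    ∀ (F : T3Family) (γ : ℝ) (hF : F.L = L) (hγ : 0 < γ), γ ≤ γB → ∀ (hγ1 : γ ≤ (min (hF ▸ 𝔠).gamma0 1) ^ 2),
      AlphaInputsT3AC.OfV3At F (hF ▸ 𝔠) a₀ a₁ →
        (∀ n, (C_s + C_B) * θBal F.L γ (hF ▸ 𝔠).b₀ (hF ▸ 𝔠).p₀ n ≤ 1) ∧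
        ∃ (p : ∀ K, AlphaInputsT3AC.PkgAtV3 F (hF ▸ 𝔠) γ hγ hγ1 K), (∀ K, (p K).a₀ = a₀ ∧ (p K).a₁ = a₁) ∧
          ∃ (π : AlphaInputsT3AC.PolymerT3 F) (PT : TermFn F) (Φ : ChartFam ↥(lieC (suGroupModel 2)) F) (e : VacFam F)
            (B : CfgFam ↥(lieC (suGroupModel 2)) F) (R : RemFam F),
            PintDecompTrivT (AlphaInputsT3AC.dataOfV3 p π) PT ∧ LocCover (AlphaInputsT3AC.dataOfV3 p π) κ C' ∧
            LocBlockVolume (AlphaInputsT3AC.dataOfV3 p π) ∧ LocMatched (AlphaInputsT3AC.dataOfV3 p π) ∧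
            TermSizeTrivT (AlphaInputsT3AC.dataOfV3 p π) PT (hF ▸ 𝔠).b₀ (hF ▸ 𝔠).p₀ C_T κ ∧
            TaylorSplitΦ PT Φ e B R ∧ FlatKernelCauchyΦ (AlphaInputsT3AC.dataOfV3 p π) Φ κ a C ∧
            KernelSizeΦ (AlphaInputsT3AC.dataOfV3 p π) Φ κ C_E ∧
            RemainderSmallΦ (AlphaInputsT3AC.dataOfV3 p π) R (hF ▸ 𝔠).b₀ (hF ▸ 𝔠).p₀ κ C_R ∧
            CfgSizeΦ (AlphaInputsT3AC.dataOfV3 p π) B (hF ▸ 𝔠).b₀ (hF ▸ 𝔠).p₀ C_s ∧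
            CfgCauchyΦ (AlphaInputsT3AC.dataOfV3 p π) B (hF ▸ 𝔠).b₀ (hF ▸ 𝔠).p₀ a C_B fun _ => 1

/-- `√γ ≤ e^{1−p₀}` once `γ ≤ e^{2(1−p₀)}` (the producer's monotonicity window for the thresholds). [folklore] -/
theorem sqrt_le_exp_of_le {γ p₀ : ℝ} (h : γ ≤ Real.exp (2 * (1 - p₀))) : Real.sqrt γ ≤ Real.exp (1 - p₀) := by
  calc Real.sqrt γ ≤ Real.sqrt (Real.exp (2 * (1 - p₀))) := Real.sqrt_le_sqrt h
    _ = Real.exp (1 - p₀) := by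
        rw [show (2 * (1 - p₀)) = (1 - p₀) + (1 - p₀) by ring, Real.exp_add, Real.sqrt_mul_self (Real.exp_pos _).le]

/-- **THE REGISTERED STUB 3⁗ FROM THE K1a LINE, BY NAME**: if for every odd `L ≥ 7`, every constants record and [7]-constants there is a rate exponent
`0 < a < 1` with `K1aLine L 𝔠 a₀ a₁ a`, then the text of `stub_globalTwoRunSlackFam` (skeleton v5j‴ `Cruxes/FluctuationComparisonRegPrL/Lines/birth_v5j3.lean`)
holds VERBATIM — threshold `γB ⊓ e^{2(1−p₀)}`, `σ = 7`, constant the producer's `max(C′,0)·(C_T + C₁/(1 − L^{a−1}) + C₁/(1 − L⁻¹))` with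
`C₁ = 5(C_s²C + 6C_sC_BC_E) + 2C_R`. [cite: King1986, Thm 3.4 (3.9) p.656, Prop. 3.6 p.662; Balaban1985UV3, (43)-(46) pp.266-267, (57) p.270] -/
theorem globalTwoRunSlackFam_of_k1aLine
    (h : ∀ (L : ℕ), Odd L → 7 ≤ L → ∀ (𝔠 : AlphaConsts L (suGroupModel 2).N) (a₀ a₁ : ℝ), 0 < a₀ → 0 < a₁ → 𝔠.B₃ * a₁ ≤ a₀ →
      ∃ a : ℝ, 0 < a ∧ a < 1 ∧ K1aLine L 𝔠 a₀ a₁ a) :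
    ∀ (L : ℕ), Odd L → 7 ≤ L → ∀ (𝔠 : Summit.QuantumFields.Balaban3D.Proofs.Primitives.AlphaConsts L (Summit.QuantumFields.Balaban3D.Carriers.suGroupModel 2).N)
      (a₀ a₁ : ℝ), 0 < a₀ → 0 < a₁ → 𝔠.B₃ * a₁ ≤ a₀ →
      ∃ a : ℝ, 0 < a ∧ ∃ γB : ℝ, 0 < γB ∧ ∀ (F : T3Family) (γ : ℝ) (hF : F.L = L) (hγ : 0 < γ), γ ≤ γB →
        ∀ (hγ1 : γ ≤ (min (hF ▸ 𝔠).gamma0 1) ^ 2),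
          Summit.QuantumFields.YangMills.Theorems.AlphaInputsT3AC.OfV3At F (hF ▸ 𝔠) a₀ a₁ →
          ∃ (p : ∀ K, Summit.QuantumFields.YangMills.Theorems.AlphaInputsT3AC.PkgAtV3 F (hF ▸ 𝔠) γ hγ hγ1 K),
            (∀ K, (p K).a₀ = a₀ ∧ (p K).a₁ = a₁) ∧
            ∃ (π : Summit.QuantumFields.YangMills.Theorems.AlphaInputsT3AC.PolymerT3 F) (σ : ℕ) (C : ℝ), 7 ≤ σ ∧ 0 ≤ C ∧
              Summit.QuantumFields.YangMills.Theorems.GlobalSlack.GlobalSupRateTSlack (Summit.QuantumFields.YangMills.Theorems.AlphaInputsT3AC.dataOfV3 p π) (hF ▸ 𝔠).b₀ (hF ▸ 𝔠).p₀ a σ C := by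
  intro L hLo h7 𝔠 a₀ a₁ ha0 ha1 hw
  obtain ⟨a, ha, ha1', κ, C, C_E, C_R, C_s, C_B, C_T, C', γB, hC, hCE, hCR, hCs, hCB, hCT, hγB, hline⟩ := h L hLo h7 𝔠 a₀ a₁ ha0 ha1 hw
  refine ⟨a, ha, min γB (Real.exp (2 * (1 - 𝔠.p₀))), lt_min hγB (Real.exp_pos _), fun F γ hF hγ hγle hγ1 hOf => ?_⟩
  subst hF
  have hγB' : γ ≤ γB := hγle.trans (min_le_left _ _)
  have hγe : Real.sqrt γ ≤ Real.exp (1 - 𝔠.p₀) := sqrt_le_exp_of_le (hγle.trans (min_le_right _ _))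
  have hγ1' : γ ≤ 1 := hγ1.trans (sq_min_one_le _ 𝔠.gamma0_pos)
  obtain ⟨hwin, p, hp, π, PT, Φ, e, B, R, hdec, hLC, hBV, hLM, hTS, hT, hK, hE, hR, hS, hBC⟩ := hline F γ rfl hγ hγB' hγ1 hOf
  obtain ⟨σ, C₀, hσ, hC₀, hG⟩ := globalTwoRunSlackTail_of_charts hγ hγ1' hγe 𝔠.b₀_pos 𝔠.p₀_pos.le ha ha1' hC hCE hCR hCs hCB hCT
    hwin hdec hLC hBV hLM hTS hT hK hE hR hS hBC
  exact ⟨p, hp, π, σ, C₀, hσ, hC₀, hG⟩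

end Summit.QuantumFields.YangMills.Theorems.GlobalSlackKernelMatching

end
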